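import Literature.MathematicalPhysics.QuantumLattice.DWaveSourceGroundEnergyEven
import Literature.MathematicalPhysics.QuantumLattice.DWaveSourceEnergyDensityTransport
import HarnessLib

/-!
# The `d`-wave order parameter IS minus half the right derivative of the sourced energy density at zero
# source, and `d`-wave order IS non-differentiability there (unconditional)

Topic `Literature/MathematicalPhysics/QuantumLattice` (namespace = path). Sequel of
`DWaveSourceEnergyDensityTransport.lean` (hubbard-cq-obsth-2: the conditional Griffiths / cusp dictionary of
`DWaveSourceEnergyDensityLimit.lean` made unconditional with `tendsto_dWaveSourceEnergyDensity`, under the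
hypothesis shape "IF `e_src` has a right derivative `e′₊(0)` …") and of `DWaveSourceGroundEnergyEven.lean`
(hubbard-cq-p5: evenness of the sourced ground energy, two-sided readings). Here the remaining regularity
hypotheses are REMOVED: `e_src(U,μ,·) = dWaveSourceEnergyDensity U μ` is concave on `ℝ`
(`concaveOn_dWaveSourceEnergyDensity`), so its one-sided derivatives exist at EVERY real source, and
the Koma–Tasaki `d`-wave order parameter `m* = dWaveOrderParameter U μ` of the pair-sourced Hubbard torus
`dWaveSourceTorus L U μ h` gets a closed form. Hubbard ladder, rung CQ, rows PC-a (pinning-field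
response) / PC-c (non-analyticity of `e₀(h)`). No definition, no named fact, no `sorry`; zero compute.

## Contents (all unconditional; `e := dWaveSourceEnergyDensity U μ`, `m_L(h) := dWaveSourceDensity L U μ h`)

* `dWaveSourceEnergyDensity_even`: `e(−h) = e(h)`.
* `hasDerivWithinAt_Ioi_Iio_dWaveSourceEnergyDensity`: at every real `h` the one-sided derivatives
  `∂⁺e(h) = derivWithin e (Ioi h) h`, `∂⁻e(h) = derivWithin e (Iio h) h` exist; `∂⁺e(h) ≤ ∂⁻e(h)`
  (`rightDeriv_le_leftDeriv_dWaveSourceEnergyDensity`).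
* `rightLeftDeriv_bracket_dWaveSourceDensity`: GRIFFITHS at every real `h` with no hypothesis,
  `−∂⁻e(h)/2 ≤ liminf_L m_{L+1}(h) ≤ limsup_L m_{L+1}(h) ≤ −∂⁺e(h)/2`.
* `dWaveOrderParameter_eq_neg_half_rightDeriv_dWaveSourceEnergyDensity`: **`m* = −∂⁺e(0)/2`**;
  `tendsto_rightDeriv_dWaveSourceEnergyDensity_nhdsGT`: `−∂⁺e(h)/2 → m*` as `h → 0⁺` (so the stair, the
  `limsup`, the secant `(e(0) − e(h))/(2h)` and `−∂⁺e(h)/2` all tend to `m*` at `0⁺`).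
* `hasDWaveOrder_iff_rightDeriv_dWaveSourceEnergyDensity_neg`: `HasDWaveOrder U μ ↔ ∂⁺e(0) < 0`;
  `tendsto_slope_dWaveSourceEnergyDensity_nhdsLT_zero` / `…nhdsGT_zero`: the one-sided slopes of `e` at `0`
  tend to `±2m*`; `hasDerivAt_dWaveSourceEnergyDensity_zero_iff`: `HasDerivAt e e′ 0 ↔ e′ = 0 ∧ m* = 0`;
  **`hasDWaveOrder_iff_not_differentiableAt_dWaveSourceEnergyDensity`: `HasDWaveOrder U μ ↔
  ¬ DifferentiableAt ℝ e 0`** — LADDER rows PC-c ("non-analyticity of `e₀(h)` at `h = 0`") and PC-a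
  ("pinning-field response as `h → 0⁺`") name one certified object, the kink `∂⁺e(0) = −∂⁻e(0) = −2m*`.

## What is NOT here (honest scope)

* Nothing asserts or refutes `HasDWaveOrder U μ` for any `(U, μ)`; no relation to long-range order
  (barrier `Literature.Barriers.HubbardSuperconductivity.SourcedOrderWithoutGroundStateLRO`); `t′ = 0`, `t = 1`
  (the tree's `dWaveSourceTorus`). A certified window on `e` at ONE `h > 0` bounds `m*` from above only
  (`dWaveOrderParameter_le_slope_energyDensity`).

## References

* R. B. Griffiths, Phys. Rev. 152 (1966) 240–246, §II. [cite: Griffiths1966, §II]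
* T. Koma, H. Tasaki, J. Stat. Phys. 76 (1994) 745–803, §1. [cite: KomaTasaki1994, §1]
-/

noncomputable section

namespace Literature.MathematicalPhysics.QuantumLattice

open Filter Set
open scoped Topology

section RightDerivative

variable (U μ : ℝ)

/-- The `[0,∞)`-restricted form of `tendsto_dWaveSourceEnergyDensity` (the hypothesis shape `hg` of the
conditional dictionary). [cite: KomaTasaki1994, §1] -/
private theorem hg_Ici (h : ℝ) (_hh : 0 ≤ h) :
    Tendsto (fun L : ℕ => (dWaveSourceTorus (L + 1) U μ h).groundEnergy / (((L + 1 : ℕ) : ℝ)) ^ 2)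
      atTop (𝓝 (dWaveSourceEnergyDensity U μ h)) :=
  tendsto_dWaveSourceEnergyDensity U μ h

/-- **`e_src` is even in the source**: `e_src(U,μ,−h) = e_src(U,μ,h)` (gauge rotation `e^{iπN/2}`).
[cite: KomaTasaki1994, §1] -/
theorem dWaveSourceEnergyDensity_even (h : ℝ) :
    dWaveSourceEnergyDensity U μ (-h) = dWaveSourceEnergyDensity U μ h :=
  even_of_tendsto_groundEnergy_dWaveSource U μ (tendsto_dWaveSourceEnergyDensity U μ) h

/-- **One-sided derivatives of `e_src` exist at every real source** (concavity on `ℝ`; Mathlib's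
one-sided differentiability of convex functions at interior points). [cite: KomaTasaki1994, §1] -/
theorem hasDerivWithinAt_Ioi_Iio_dWaveSourceEnergyDensity (h : ℝ) :
    HasDerivWithinAt (dWaveSourceEnergyDensity U μ)
        (derivWithin (dWaveSourceEnergyDensity U μ) (Set.Ioi h) h) (Set.Ioi h) h ∧
      HasDerivWithinAt (dWaveSourceEnergyDensity U μ)
        (derivWithin (dWaveSourceEnergyDensity U μ) (Set.Iio h) h) (Set.Iio h) h := by
  have hc := (concaveOn_dWaveSourceEnergyDensity U μ).neg
  have hint : h ∈ interior (Set.univ : Set ℝ) := by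
    rw [interior_univ]
    exact Set.mem_univ h
  have hR := (hc.differentiableWithinAt_Ioi_of_mem_interior hint).neg
  have hL := (hc.differentiableWithinAt_Iio_of_mem_interior hint).neg
  simp only [neg_neg] at hR hL
  exact ⟨hR.hasDerivWithinAt, hL.hasDerivWithinAt⟩

/-- **`∂⁺e_src(h) ≤ ∂⁻e_src(h)`** at every real source (concavity). [cite: KomaTasaki1994, §1] -/
theorem rightDeriv_le_leftDeriv_dWaveSourceEnergyDensity (h : ℝ) :
    derivWithin (dWaveSourceEnergyDensity U μ) (Set.Ioi h) h ≤
      derivWithin (dWaveSourceEnergyDensity U μ) (Set.Iio h) h := by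
  have hc := (concaveOn_dWaveSourceEnergyDensity U μ).neg
  have hint : h ∈ interior (Set.univ : Set ℝ) := by
    rw [interior_univ]
    exact Set.mem_univ h
  have key := hc.leftDeriv_le_rightDeriv_of_mem_interior hint
  have e1 : (-fun h : ℝ => dWaveSourceEnergyDensity U μ h) = -dWaveSourceEnergyDensity U μ := rfl
  rw [e1, derivWithin.neg, derivWithin.neg] at key
  linarith

/-- **Griffiths' bracket at every real source, no hypothesis**:
`−∂⁻e_src(h)/2 ≤ liminf_L m_{L+1}(h) ≤ limsup_L m_{L+1}(h) ≤ −∂⁺e_src(h)/2`. [cite: Griffiths1966, §II] -/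
theorem rightLeftDeriv_bracket_dWaveSourceDensity (h : ℝ) :
    -derivWithin (dWaveSourceEnergyDensity U μ) (Set.Iio h) h / 2 ≤
        liminf (fun L : ℕ => dWaveSourceDensity (L + 1) U μ h) atTop ∧
      liminf (fun L : ℕ => dWaveSourceDensity (L + 1) U μ h) atTop ≤
        limsup (fun L : ℕ => dWaveSourceDensity (L + 1) U μ h) atTop ∧
      limsup (fun L : ℕ => dWaveSourceDensity (L + 1) U μ h) atTop ≤
        -derivWithin (dWaveSourceEnergyDensity U μ) (Set.Ioi h) h / 2 := by
  obtain ⟨hR, hL⟩ := hasDerivWithinAt_Ioi_Iio_dWaveSourceEnergyDensity U μ h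
  refine ⟨neg_half_leftDeriv_le_liminf_dWaveSourceDensity U μ hL, ?_,
    limsup_dWaveSourceDensity_le_neg_half_rightDeriv U μ hR⟩
  exact liminf_le_limsup
    (isBoundedUnder_of ⟨_, fun L => (abs_le.1 (abs_dWaveSourceDensity_le (L + 1) U μ h)).2⟩)
    (isBoundedUnder_of ⟨_, fun L => (abs_le.1 (abs_dWaveSourceDensity_le (L + 1) U μ h)).1⟩)

/-- **THE CUSP IDENTITY, closed form**: the Koma–Tasaki `d`-wave order parameter is minus half the RIGHT
DERIVATIVE of the sourced energy density at zero source,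
`dWaveOrderParameter U μ = −(derivWithin e_src (Ioi 0) 0)/2`. [cite: Griffiths1966, §II] -/
theorem dWaveOrderParameter_eq_neg_half_rightDeriv_dWaveSourceEnergyDensity :
    dWaveOrderParameter U μ = -derivWithin (dWaveSourceEnergyDensity U μ) (Set.Ioi 0) 0 / 2 :=
  dWaveOrderParameter_eq_neg_half_rightDeriv_energyDensity U μ
    (hasDerivWithinAt_Ioi_Iio_dWaveSourceEnergyDensity U μ 0).1

/-- **The right derivative is right-continuous at `0` in order-parameter units**:
`−∂⁺e_src(h)/2 → dWaveOrderParameter U μ` as `h → 0⁺`. [cite: Griffiths1966, §II] -/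
theorem tendsto_rightDeriv_dWaveSourceEnergyDensity_nhdsGT :
    Tendsto (fun h : ℝ => -derivWithin (dWaveSourceEnergyDensity U μ) (Set.Ioi h) h / 2) (𝓝[>] 0)
      (𝓝 (dWaveOrderParameter U μ)) :=
  tendsto_derivWithin_Ioi_nhdsGT_dWaveOrderParameter U μ (hg_Ici U μ)

/-- **Order = negative right derivative**: `HasDWaveOrder U μ ↔ derivWithin e_src (Ioi 0) 0 < 0`.
[cite: KomaTasaki1994, §1] -/
theorem hasDWaveOrder_iff_rightDeriv_dWaveSourceEnergyDensity_neg :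
    HasDWaveOrder U μ ↔ derivWithin (dWaveSourceEnergyDensity U μ) (Set.Ioi 0) 0 < 0 :=
  hasDWaveOrder_iff_rightDeriv_energyDensity_neg U μ
    (hasDerivWithinAt_Ioi_Iio_dWaveSourceEnergyDensity U μ 0).1

/-- The RIGHT slope of `e_src` at `0` tends to `−2·dWaveOrderParameter U μ`. [cite: Griffiths1966, §II] -/
theorem tendsto_slope_dWaveSourceEnergyDensity_nhdsGT_zero :
    Tendsto (slope (dWaveSourceEnergyDensity U μ) 0) (𝓝[>] 0) (𝓝 (-2 * dWaveOrderParameter U μ)) :=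
  tendsto_slope_nhdsGT_zero_dWaveSource U μ (hg_Ici U μ)

/-- The LEFT slope of `e_src` at `0` tends to `+2·dWaveOrderParameter U μ` (evenness).
[cite: Griffiths1966, §II] -/
theorem tendsto_slope_dWaveSourceEnergyDensity_nhdsLT_zero :
    Tendsto (slope (dWaveSourceEnergyDensity U μ) 0) (𝓝[<] 0) (𝓝 (2 * dWaveOrderParameter U μ)) :=
  tendsto_slope_nhdsLT_zero_dWaveSource U μ (tendsto_dWaveSourceEnergyDensity U μ)

/-- `∂⁻e_src(0) = −∂⁺e_src(0) = 2·dWaveOrderParameter U μ`: the kink at zero source is symmetric.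
[cite: Griffiths1966, §II] -/
theorem leftDeriv_dWaveSourceEnergyDensity_zero :
    derivWithin (dWaveSourceEnergyDensity U μ) (Set.Iio 0) 0 = 2 * dWaveOrderParameter U μ := by
  have hL := (hasDerivWithinAt_Ioi_Iio_dWaveSourceEnergyDensity U μ 0).2
  have hsl : Tendsto (slope (dWaveSourceEnergyDensity U μ) 0) (𝓝[<] 0)
      (𝓝 (derivWithin (dWaveSourceEnergyDensity U μ) (Set.Iio 0) 0)) :=
    (hasDerivWithinAt_iff_tendsto_slope' (by simp)).1 hL
  exact tendsto_nhds_unique hsl (tendsto_slope_dWaveSourceEnergyDensity_nhdsLT_zero U μ)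

/-- **Differentiability at zero source ⇔ no order**:
`HasDerivAt e_src e′ 0 ↔ e′ = 0 ∧ dWaveOrderParameter U μ = 0`. [cite: Griffiths1966, §II] -/
theorem hasDerivAt_dWaveSourceEnergyDensity_zero_iff {e' : ℝ} :
    HasDerivAt (dWaveSourceEnergyDensity U μ) e' 0 ↔ e' = 0 ∧ dWaveOrderParameter U μ = 0 :=
  hasDerivAt_zero_iff_dWaveOrderParameter_eq_zero U μ (tendsto_dWaveSourceEnergyDensity U μ)

/-- **`d`-WAVE ORDER IS A KINK OF THE SOURCED ENERGY DENSITY AT ZERO SOURCE** (the literal identity of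
LADDER rows PC-c "non-analyticity of `e₀(h)`" and PC-a "pinning-field response"):
`HasDWaveOrder U μ ↔ ¬ DifferentiableAt ℝ e_src 0`. [cite: KomaTasaki1994, §1] -/
theorem hasDWaveOrder_iff_not_differentiableAt_dWaveSourceEnergyDensity :
    HasDWaveOrder U μ ↔ ¬ DifferentiableAt ℝ (dWaveSourceEnergyDensity U μ) 0 :=
  hasDWaveOrder_iff_not_differentiableAt_zero U μ (tendsto_dWaveSourceEnergyDensity U μ)

/-- … equivalently `¬ HasDWaveOrder U μ ↔ HasDerivAt e_src 0 0`. [cite: KomaTasaki1994, §1] -/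
theorem not_hasDWaveOrder_iff_hasDerivAt_dWaveSourceEnergyDensity_zero :
    ¬ HasDWaveOrder U μ ↔ HasDerivAt (dWaveSourceEnergyDensity U μ) 0 0 :=
  not_hasDWaveOrder_iff_hasDerivAt_zero U μ (tendsto_dWaveSourceEnergyDensity U μ)

end RightDerivative

/-! ### Appended 2026-08-26 (hubbard-cq-p5): the thermodynamic-limit RESPONSE FUNCTION
`m(h) := −∂⁺e_src(h)/2` — monotone, equal to `lim_L m_{L+1}(h)` off the countable kink set of `e_src` -/

section ResponseFunction

/-- **A convex function on `ℝ` is differentiable off a countable set**: its right derivative is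
monotone, hence continuous off a countable set, and wherever the right derivative is continuous the
left and right derivatives agree (`r(y) ≤ ℓ(x) ≤ r(x)` for `y < x`). [cite: Rockafellar1970, Thm. 25.3] -/
theorem countable_not_differentiableAt_of_convexOn_univ {f : ℝ → ℝ} (hfc : ConvexOn ℝ Set.univ f) :
    Set.Countable {x : ℝ | ¬ DifferentiableAt ℝ f x} := by
  have hint : ∀ x : ℝ, x ∈ interior (Set.univ : Set ℝ) := fun x => by
    rw [interior_univ]
    exact Set.mem_univ x
  have hmono : Monotone fun x : ℝ => derivWithin f (Set.Ioi x) x := by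
    have key := hfc.monotoneOn_rightDeriv
    rw [interior_univ] at key
    exact monotoneOn_univ.1 key
  refine hmono.countable_not_continuousAt.mono fun x hx => ?_
  simp only [Set.mem_setOf_eq] at hx ⊢
  intro hcont
  apply hx
  have hR := hfc.hasDerivWithinAt_rightDeriv_of_mem_interior (hint x)
  have hL := hfc.hasDerivWithinAt_leftDeriv_of_mem_interior (hint x)
  -- `ℓ(x) ≤ r(x)` and `r(y) ≤ slope f y x ≤ ℓ(x)` for `y < x`
  have h1 := hfc.leftDeriv_le_rightDeriv_of_mem_interior (hint x)
  have h2 : ∀ y : ℝ, y < x → derivWithin f (Set.Ioi y) y ≤ derivWithin f (Set.Iio x) x := fun y hy =>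
    (hfc.rightDeriv_le_slope_of_mem_interior (hint y) (Set.mem_univ x) hy).trans
      (hfc.slope_le_leftDeriv_of_mem_interior (Set.mem_univ y) (hint x) hy)
  -- left-continuity of `r` at `x` forces `r(x) ≤ ℓ(x)`
  have h3 : derivWithin f (Set.Ioi x) x ≤ derivWithin f (Set.Iio x) x := by
    have ht : Tendsto (fun y : ℝ => derivWithin f (Set.Ioi y) y) (𝓝[<] x)
        (𝓝 (derivWithin f (Set.Ioi x) x)) := hcont.tendsto.mono_left nhdsWithin_le_nhds
    exact le_of_tendsto ht (eventually_nhdsWithin_of_forall fun y hy => h2 y hy)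
  have heq : derivWithin f (Set.Iio x) x = derivWithin f (Set.Ioi x) x := le_antisymm h1 h3
  rw [heq] at hL
  have hslL := (hasDerivWithinAt_iff_tendsto_slope' (by simp)).1 hL
  have hslR := (hasDerivWithinAt_iff_tendsto_slope' (by simp)).1 hR
  exact (hasDerivAt_iff_tendsto_slope_left_right.2 ⟨hslL, hslR⟩).differentiableAt

variable (U μ : ℝ)

/-- **The kinks of `e_src` are countable**: `h ↦ dWaveSourceEnergyDensity U μ h` is differentiable at all
but countably many real `h` (concavity). [cite: Rockafellar1970, Thm. 25.3] -/
theorem countable_not_differentiableAt_dWaveSourceEnergyDensity :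
    Set.Countable {h : ℝ | ¬ DifferentiableAt ℝ (dWaveSourceEnergyDensity U μ) h} := by
  have key := countable_not_differentiableAt_of_convexOn_univ (concaveOn_dWaveSourceEnergyDensity U μ).neg
  refine key.mono fun h hh => ?_
  simp only [Set.mem_setOf_eq] at hh ⊢
  intro hd
  exact hh (by simpa using hd.neg)

/-- **The thermodynamic-limit response function** `m(h) := −∂⁺e_src(h)/2` is non-decreasing on `ℝ`
(concavity of `e_src`). [cite: KomaTasaki1994, §1] -/
theorem monotone_neg_half_rightDeriv_dWaveSourceEnergyDensity :
    Monotone fun h : ℝ => -derivWithin (dWaveSourceEnergyDensity U μ) (Set.Ioi h) h / 2 := by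
  have key := (concaveOn_dWaveSourceEnergyDensity U μ).neg.monotoneOn_rightDeriv
  rw [interior_univ] at key
  have e1 : (-fun h : ℝ => dWaveSourceEnergyDensity U μ h) = -dWaveSourceEnergyDensity U μ := rfl
  intro h h' hle
  have := monotoneOn_univ.1 key hle
  simp only [e1, derivWithin.neg] at this
  dsimp only
  linarith

/-- **Off the countable kink set the finite-volume responses CONVERGE to the response function**:
at every differentiability point `h` of `e_src`, `m_{L+1}(h) → −∂⁺e_src(h)/2 = −e_src′(h)/2`.
[cite: Griffiths1966, §II] -/
theorem tendsto_dWaveSourceDensity_of_differentiableAt {h : ℝ}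
    (hd : DifferentiableAt ℝ (dWaveSourceEnergyDensity U μ) h) :
    Tendsto (fun L : ℕ => dWaveSourceDensity (L + 1) U μ h) atTop
      (𝓝 (-derivWithin (dWaveSourceEnergyDensity U μ) (Set.Ioi h) h / 2)) := by
  have hderiv := hd.hasDerivAt
  have hW : derivWithin (dWaveSourceEnergyDensity U μ) (Set.Ioi h) h = deriv (dWaveSourceEnergyDensity U μ) h :=
    hderiv.hasDerivWithinAt.derivWithin (uniqueDiffWithinAt_Ioi h)
  rw [hW]
  exact tendsto_dWaveSourceDensity_of_hasDerivAt_energyDensity U μ hderiv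

/-- **Hence `m_{L+1}(h)` converges for all but countably many sources `h`** (to the response function).
[cite: Griffiths1966, §II] -/
theorem countable_not_tendsto_dWaveSourceDensity :
    Set.Countable {h : ℝ | ¬ Tendsto (fun L : ℕ => dWaveSourceDensity (L + 1) U μ h) atTop
      (𝓝 (-derivWithin (dWaveSourceEnergyDensity U μ) (Set.Ioi h) h / 2))} :=
  (countable_not_differentiableAt_dWaveSourceEnergyDensity U μ).mono fun _ hh hd =>
    hh (tendsto_dWaveSourceDensity_of_differentiableAt U μ hd)

/-- **The response function bounds every stair from above and tends to the order parameter**: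
`liminf_L m_{L+1}(h) ≤ limsup_L m_{L+1}(h) ≤ −∂⁺e_src(h)/2` at every `h`, `dWaveOrderParameter U μ ≤
−∂⁺e_src(h)/2` for `h > 0`, and `−∂⁺e_src(h)/2 → dWaveOrderParameter U μ` as `h → 0⁺`
(`tendsto_rightDeriv_dWaveSourceEnergyDensity_nhdsGT`). [cite: KomaTasaki1994, §1] -/
theorem dWaveOrderParameter_le_neg_half_rightDeriv_dWaveSourceEnergyDensity {h : ℝ} (hh : 0 < h) :
    dWaveOrderParameter U μ ≤ -derivWithin (dWaveSourceEnergyDensity U μ) (Set.Ioi h) h / 2 := by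
  obtain ⟨-, h2, h3⟩ := rightLeftDeriv_bracket_dWaveSourceDensity U μ h
  exact ((dWaveOrderParameter_le_liminf U μ hh).trans h2).trans h3

end ResponseFunction

end Literature.MathematicalPhysics.QuantumLattice

end
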